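import Literature.MathematicalPhysics.QuantumFieldTheory.ONMixedSumRule

/-!
# OPE-coefficient symmetry `λ_{φφs} = λ_{φsφ}` and the `θ`-scan in the `O(N)` `{φ_i, s}` system

Typed verbatim from Kos–Poland–Simmons-Duffin–Vichi, *Bootstrapping the O(N) archipelago*, JHEP 11
(2015) 106 [arXiv:1504.07997], §2.2 (last bullet and the example SDP) and Kos–Poland–Simmons-Duffin–Vichi,
*Precision islands in the Ising and O(N) models*, JHEP 08 (2016) 036 [arXiv:1603.04436], §2.1–§2.2, on top
of `ONMixedSumRule.lean` (the seven-equation system `V⃗_S, V⃗_T, V⃗_A, V⃗_V` and its exclusion step).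

SOURCE (2015, §2.2, last bullet).  *"Another important input is the equality of the OPE coefficients
`λ_{φφs} = λ_{φsφ}`.  This is a trivial consequence of conformal invariance.  It is important that `φ` and `s`
be isolated in the operator spectrum for us to be able to exploit this constraint. …"*; the example SDP
(2015, eq. "example") ends with the constraint *"`α⃗·(V⃗_{S,Δ_s,0} + V⃗_{V,Δ_φ,0} ⊗ (1 0; 0 0)) ⪰ 0`"*, and
*"The final constraint … imposes the appearance of `φ_i, s` in the OPEs and incorporates the equality
`λ_{φφs} = λ_{φsφ}`.  It replaces two otherwise independent constraints on `V_S` and `V_V`.  As previously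
mentioned, if we assume no gap between `φ_i`, `s` and the next operators in each sector, enforcing symmetry
of the OPE coefficients will have no effect: indeed each of the terms in this constraint would be
independently positive-semidefinite …"*.

SOURCE (2016, §2.1, for the `ℤ₂` system, then §2.2 *"Similarly"* for `O(N)`).  *"However … the condition
(OPE relation) is still stronger than necessary.  In particular it allows for solutions of crossing
containing terms of the form `Σ_i (λ_i λ_i)(V⃗ + V⃗ ⊗ (1 0;0 0))(λ_i; λ_i)` where (the `λ_i`) represent an
arbitrary number of (not necessarily aligned) two-component vectors.  If instead we assume that [the
externals] are isolated and that there are no other contributions at their scaling dimensions, then we can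
replace (it) with the weaker condition `(cos θ  sin θ) α⃗·(V⃗ + V⃗ ⊗ (1 0; 0 0)) (cos θ; sin θ) ≥ 0` for some
unknown angle `θ` … By scanning over the possible values of `θ` and taking the union of the resulting
allowed regions … we can effectively allow our functional to depend on this unknown ratio"*; *"for any
given allowed point … we can compute a lower and upper bound on the norm … of the OPE coefficient vector …
Maximize `(1 1) α⃗·V⃗_{unit} (1 1)ᵀ` subject to `𝒩 = (cos θ sin θ) α⃗·(…)(cos θ; sin θ)`, (positivity on the
rest) … By choosing `𝒩 = ±1` we can obtain the sought upper and lower bounds `𝒩 λ² ≤ −(1 1) α⃗·V⃗_{unit}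
(1 1)ᵀ`"*.  §2.2 (`O(N)`): the generic conditions *"`(1 1) α⃗·V⃗_{S,0,0} (1;1) ≥ 0` for the identity operator,
`α⃗·V⃗_{T,Δ,ℓ} ≥ 0` …, `α⃗·V⃗_{A,Δ,ℓ} ≥ 0` …, `α⃗·V⃗_{V,Δ,ℓ} ≥ 0` …, `α⃗·V⃗_{S,Δ,ℓ} ⪰ 0` for singlets with `ℓ`
even"* and *"we will additionally allow for the contributions of the isolated operators `φ_i` and `s` by
imposing the condition `(cos θ_N  sin θ_N) α⃗·(V⃗_{S,Δ_s,0} + V⃗_{V,Δ_φ,0} ⊗ (1 0; 0 0)) (cos θ_N; sin θ_N) ≥ 0`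
and scanning over the unknown angle `θ_N`"*, with (2016, §2.2, next paragraph) *"`λ_s ≡ √(λ²_{φφs} +
λ²_{sss})`"*.

RENDERING.  As in `ONMixedSumRule.lean`, channel functions are opaque `g : ℝ → ℝ → ℝ`, a functional is a
real-linear map on `ℝ → ℝ → (Fin 7 → ℝ)`, spectrum assumptions are encoded by the index types of the
families, and `s = (Δφ+Δs)/2`.  The isolated externals enter through three channel functions: `gs` (the
block of `s` in `V⃗_S`, couplings `(λ_{φφs}, λ_{sss}) = (a, b)`), and `gφ₁, gφ₂` (the two blocks of `φ` in
`V⃗_V`, spin `0` so `ε = 1`, coupling `λ²_{φsφ} = a²` — THIS is where `λ_{φφs} = λ_{φsφ}` is used).  The source's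
direction `(cos θ_N, sin θ_N)` is typed as an arbitrary direction `(c, d)` with `(a, b) = λ (c, d)`
(`dir_quadForm_smul`: rescaling the direction rescales the condition by `r² ≥ 0`, so nothing depends on the
normalisation `c² + d² = 1`; the verbatim `θ` form is `exists_norm_angle` / the `θ` corollaries).

WHAT IS PROVED.  (1) `V7Ext = V⃗_S[gs] + V⃗_V[1; gφ₁, gφ₂] ⊗ (1 0;0 0)` and its quadratic form
`quadExt a b = (a b) V7Ext (a b)ᵀ = (a b) V⃗_S[gs] (a b)ᵀ + a² V⃗_V` (`quadExt_eq`: "replaces two otherwise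
independent constraints"), closed form `quadExt_eq_vec`, homogeneity `quadExt_smul`, sign blindness
`quadExt_neg`.  (2) `alphaExt α = α⃗·(V⃗_S + V⃗_V ⊗ (1 0;0 0))` with `alphaExt_quadForm`; `⪰ 0 ⇒` every aligned OR
non-aligned family of two-vectors contributes `≥ 0` (`quadExt_nonneg_of_posSemidef`,
`sum_quadExt_nonneg_of_posSemidef` — the "strong version"); the direction condition `⇒` the contribution of
couplings ALONG that direction is `≥ 0` (`quadExt_nonneg_of_dir` — the "weaker condition"); `⪰ 0` implies
the direction condition for every direction (`dir_nonneg_of_posSemidef`); and "no effect without gaps":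
`α⃗·V⃗_S[gs] ⪰ 0 ∧ α⃗·V⃗_V ≥ 0 ⇒ alphaExt ⪰ 0` (`posSemidef_alphaExt_of_parts`).  (3) The seven rows with the
unit AND the isolated externals split off (`mixedVec_ext_split`).  (4) The exclusion step with the
`θ`-condition in place of `⪰ 0` for the externals: `false_of_functional₇_dir` (generic `α`, termwise
application as hypotheses) and `false_of_pointFunctional₇_dir` (point functionals, every hypothesis
explicit, `2 ≤ N`).  (5) The norm bounds: `normSq_bound_of_functional₇` (`𝒩 λ² ≤ −(1 1) α⃗·V⃗_{S,0,0} (1 1)ᵀ`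
for ANY value `𝒩` of the direction form — no condition on the unit is needed here), with `𝒩 = ±1`
corollaries `normSq_le_of_functional₇`, `le_normSq_of_functional₇`.  (6) The scan: every coupling pair is
`λ (cos θ, sin θ)` with `λ = √(a² + b²) ≥ 0` (`exists_norm_angle`), hence "excluded at every `θ`" excludes
the point (`false_of_forall_angle`), and by `quadExt_neg` a half-turn of angles suffices
(`exists_norm_angle_Ico`: `θ ∈ [0, π)` with a signed `λ`).

STRICTNESS.  The 2016 `O(N)` list prints `≥ 0` for the identity; with `≥ 0` everywhere the zero functional
qualifies, so a normalisation is implicit (the 2014 single-correlator text prints `> 0`; SDPB normalises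
`α⃗·(unit) = 1`).  The exclusion theorems here keep the STRICT unit condition of `ONMixedSumRule.lean`; the
norm-bound theorem has NO unit condition (its normalisation is `𝒩`).

NOT COVERED.  The `ℤ₂` (`σ, ε`) version of 2016 §2.1 over the five-row system of
`ConformalBootstrap3D/SigmaEpsilonSystem.lean` (same algebra with `V⃗_+, V⃗_-`; recorded there as untyped,
module note (6)); the `θ`-grid actually used in a computation and the cover argument turning finitely many
angles plus interval slack into "every `θ`" (a certificate obligation of the client cell, cf. the `Δ`-grid
cover lemmas of `ConformalBootstrap3D/DualFunctional.lean`); derivative functionals (termwise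
differentiability); conformal-block enclosures; 2016 §2.3 (`c`-minimisation) and App. A (3d scans).
-/

noncomputable section

open Finset Matrix
open Literature.MathematicalPhysics.QuantumFieldTheory.ONVectorSumRule
open Literature.MathematicalPhysics.QuantumFieldTheory.ONMixedSumRule

namespace Literature.MathematicalPhysics.QuantumFieldTheory.ONOPEAngleScan

variable {N : ℕ}

/-! ## 1. The combined external constraint `V⃗_{S,Δ_s,0} + V⃗_{V,Δ_φ,0} ⊗ (1 0; 0 0)` -/

/-- The matrix `(1 0; 0 0)` of the source's `⊗ (1 0; 0 0)`: it places the `O(N)`-vector contribution of the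
external `φ` (coupling `λ²_{φsφ} = λ²_{φφs}`) in the `(1,1)` = `(φφ, φφ)` slot of the singlet `2 × 2` blocks.
[cite: KosPolandSimmonsDuffinVichi2015, §2.2 (example SDP, last constraint)] -/
def E11 : Matrix (Fin 2) (Fin 2) ℝ := !![1, 0; 0, 0]

/-- `(a b) (1 0; 0 0) (a b)ᵀ = a²`. [cite: KosPolandSimmonsDuffinVichi2015, §2.2 (example SDP, last constraint)] -/
theorem E11_quadForm (a b : ℝ) : ![a, b] ⬝ᵥ (E11 *ᵥ ![a, b]) = a ^ 2 := by
  simp [E11, Matrix.mulVec, dotProduct, Fin.sum_univ_two]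
  ring

/-- Rescaling the direction rescales a `2 × 2` quadratic form by `r²`:
`(rc rd) M (rc rd)ᵀ = r² (c d) M (c d)ᵀ` — so the source's unit direction `(cos θ, sin θ)` may be replaced
by any nonzero multiple. [cite: KosPolandSimmonsDuffinVichi2016, §2.2 (`θ_N` condition; arXiv:1603.04436)] -/
theorem dir_quadForm_smul (M : Matrix (Fin 2) (Fin 2) ℝ) (r c d : ℝ) :
    ![r * c, r * d] ⬝ᵥ (M *ᵥ ![r * c, r * d]) = r ^ 2 * (![c, d] ⬝ᵥ (M *ᵥ ![c, d])) := by
  simp [Matrix.mulVec, dotProduct, Fin.sum_univ_two]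
  ring

/-- **`V⃗_{S,Δ_s,0}[g_s] + V⃗_{V,Δ_φ,0}[g_{φ,1}, g_{φ,2}] ⊗ (1 0; 0 0)`**: the 7-vector of `2 × 2` matrices
carrying the joint contribution of the isolated externals — `s` exchanged as a singlet in `φ × φ` and
`s × s` (block `gs`), `φ` exchanged as an `O(N)` vector in `φ × s` (spin `0`, `ε = 1`, blocks `gφ₁, gφ₂`).
[cite: KosPolandSimmonsDuffinVichi2015, §2.2 (example SDP, last constraint)]
[cite: KosPolandSimmonsDuffinVichi2016, §2.2 (`θ_N` condition; arXiv:1603.04436)] -/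
def V7Ext (Δφ Δs : ℝ) (gs gφ₁ gφ₂ : ℝ → ℝ → ℝ) (u v : ℝ) : Fin 7 → Matrix (Fin 2) (Fin 2) ℝ :=
  fun r => V7S Δφ Δs gs u v r + V7V Δφ Δs 1 gφ₁ gφ₂ u v r • E11

/-- The externals' term of the vector equation for couplings `(λ_{φφs}, λ_{sss}) = (a, b)` (and
`λ_{φsφ} = a`): the 7-vector `(a b) (V⃗_S[gs] + V⃗_V ⊗ (1 0;0 0)) (a b)ᵀ`.
[cite: KosPolandSimmonsDuffinVichi2015, §2.2 (example SDP, last constraint)] -/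
def quadExt (Δφ Δs a b : ℝ) (gs gφ₁ gφ₂ : ℝ → ℝ → ℝ) (u v : ℝ) : Fin 7 → ℝ :=
  fun r => ![a, b] ⬝ᵥ (V7Ext Δφ Δs gs gφ₁ gφ₂ u v r *ᵥ ![a, b])

/-- **"It replaces two otherwise independent constraints on `V_S` and `V_V`"**: the externals' term is the
singlet term of `s` plus `a² = λ²_{φsφ}` times the vector term of `φ`,
`(a b) V7Ext (a b)ᵀ = (a b) V⃗_S[gs] (a b)ᵀ + a² V⃗_V[1; gφ₁, gφ₂]` — the equality `λ_{φφs} = λ_{φsφ}` ties the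
two. [cite: KosPolandSimmonsDuffinVichi2015, §2.2 (OPE-coefficient equality; example SDP)] -/
theorem quadExt_eq (Δφ Δs a b : ℝ) (gs gφ₁ gφ₂ : ℝ → ℝ → ℝ) (u v : ℝ) :
    quadExt Δφ Δs a b gs gφ₁ gφ₂ u v =
      quadVS Δφ Δs a b gs u v + a ^ 2 • V7V Δφ Δs 1 gφ₁ gφ₂ u v := by
  funext r
  simp only [quadExt, V7Ext, quadVS, Matrix.add_mulVec, dotProduct_add, Matrix.smul_mulVec,
    dotProduct_smul, E11_quadForm, Pi.add_apply, Pi.smul_apply, smul_eq_mul]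
  ring

/-- Closed form of the externals' term, row by row (`s = (Δφ+Δs)/2`):
`(0, a² F^{Δφ}_-[gs], a² F^{Δφ}_+[gs], b² F^{Δs}_-[gs], a² F^{s}_-[gφ₁], ab F^{s}_-[gs] + a² F^{Δφ}_-[gφ₂],
ab F^{s}_+[gs] − a² F^{Δφ}_+[gφ₂])`. [cite: KosPolandSimmonsDuffinVichi2015, §2.1 (seven equations), §2.2 (example SDP)] -/
theorem quadExt_eq_vec (Δφ Δs a b : ℝ) (gs gφ₁ gφ₂ : ℝ → ℝ → ℝ) (u v : ℝ) :
    quadExt Δφ Δs a b gs gφ₁ gφ₂ u v =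
      ![0, a ^ 2 * Fm Δφ gs u v, a ^ 2 * Fp Δφ gs u v, b ^ 2 * Fm Δs gs u v,
        a ^ 2 * Fm ((Δφ + Δs) / 2) gφ₁ u v,
        a * b * Fm ((Δφ + Δs) / 2) gs u v + a ^ 2 * Fm Δφ gφ₂ u v,
        a * b * Fp ((Δφ + Δs) / 2) gs u v - a ^ 2 * Fp Δφ gφ₂ u v] := by
  rw [quadExt_eq, quadVS_eq]
  funext r
  fin_cases r <;> simp [V7V]
  all_goals ring

/-- Homogeneity: couplings `λ (c, d)` contribute `λ²` times the term of `(c, d)`.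
[cite: KosPolandSimmonsDuffinVichi2016, §2.2 (`θ_N` condition; arXiv:1603.04436)] -/
theorem quadExt_smul (Δφ Δs lam c d : ℝ) (gs gφ₁ gφ₂ : ℝ → ℝ → ℝ) :
    quadExt Δφ Δs (lam * c) (lam * d) gs gφ₁ gφ₂ = lam ^ 2 • quadExt Δφ Δs c d gs gφ₁ gφ₂ := by
  funext u v r
  simp only [quadExt_eq_vec, Pi.smul_apply, smul_eq_mul]
  fin_cases r <;> simp <;> ring

/-- Sign blindness: `(−a, −b)` and `(a, b)` contribute the same term, so angles `θ` and `θ + π` are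
equivalent and a half-turn of angles suffices for the scan.
[cite: KosPolandSimmonsDuffinVichi2016, §2.1–§2.2 (`θ`-scan; arXiv:1603.04436)] -/
theorem quadExt_neg (Δφ Δs a b : ℝ) (gs gφ₁ gφ₂ : ℝ → ℝ → ℝ) :
    quadExt Δφ Δs (-a) (-b) gs gφ₁ gφ₂ = quadExt Δφ Δs a b gs gφ₁ gφ₂ := by
  have h := quadExt_smul Δφ Δs (-1) a b gs gφ₁ gφ₂
  simp only [neg_mul, one_mul] at h
  rw [h]
  norm_num

/-! ## 2. The functional side: `⪰ 0` (2015) versus the direction condition (2016) -/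

/-- **`α⃗·(V⃗_{S,Δ_s,0} + V⃗_{V,Δ_φ,0} ⊗ (1 0; 0 0))`**: the real symmetric `2 × 2` matrix
`α⃗·V⃗_S[gs] + α(V⃗_V[1; gφ₁, gφ₂]) · (1 0; 0 0)`.
[cite: KosPolandSimmonsDuffinVichi2015, §2.2 (example SDP, last constraint)]
[cite: KosPolandSimmonsDuffinVichi2016, §2.2 (`θ_N` condition; arXiv:1603.04436)] -/
def alphaExt (α : (ℝ → ℝ → Fin 7 → ℝ) →ₗ[ℝ] ℝ) (Δφ Δs : ℝ) (gs gφ₁ gφ₂ : ℝ → ℝ → ℝ) :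
    Matrix (Fin 2) (Fin 2) ℝ :=
  alphaVS α Δφ Δs gs + α (V7V Δφ Δs 1 gφ₁ gφ₂) • E11

/-- `(a b) (α⃗·(V⃗_S + V⃗_V ⊗ (1 0;0 0))) (a b)ᵀ = α((a b) V7Ext (a b)ᵀ)` (linearity).
[cite: KosPolandSimmonsDuffinVichi2015, §2.2 (example SDP, last constraint)] -/
theorem alphaExt_quadForm (α : (ℝ → ℝ → Fin 7 → ℝ) →ₗ[ℝ] ℝ) (Δφ Δs a b : ℝ)
    (gs gφ₁ gφ₂ : ℝ → ℝ → ℝ) :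
    ![a, b] ⬝ᵥ (alphaExt α Δφ Δs gs gφ₁ gφ₂ *ᵥ ![a, b]) = α (quadExt Δφ Δs a b gs gφ₁ gφ₂) := by
  have e : quadExt Δφ Δs a b gs gφ₁ gφ₂ = quadVS Δφ Δs a b gs + a ^ 2 • V7V Δφ Δs 1 gφ₁ gφ₂ := by
    funext u v
    exact quadExt_eq Δφ Δs a b gs gφ₁ gφ₂ u v
  rw [e, map_add, map_smul, ← alphaVS_quadForm, smul_eq_mul]
  simp only [alphaExt, Matrix.add_mulVec, dotProduct_add, Matrix.smul_mulVec, dotProduct_smul,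
    E11_quadForm, smul_eq_mul]
  ring

/-- **The 2015 condition `⪰ 0`** ("strong version"): if `α⃗·(V⃗_S + V⃗_V ⊗ (1 0;0 0)) ⪰ 0` then the applied
externals' term is `≥ 0` for EVERY coupling pair `(a, b)`, aligned with the true `(λ_{φφs}, λ_{sss})` or not.
[cite: KosPolandSimmonsDuffinVichi2015, §2.2 (example SDP, last constraint)]
[cite: KosPolandSimmonsDuffinVichi2016, §2.1 (strong version; arXiv:1603.04436)] -/
theorem quadExt_nonneg_of_posSemidef (α : (ℝ → ℝ → Fin 7 → ℝ) →ₗ[ℝ] ℝ) {Δφ Δs : ℝ}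
    {gs gφ₁ gφ₂ : ℝ → ℝ → ℝ} (h : (alphaExt α Δφ Δs gs gφ₁ gφ₂).PosSemidef) (a b : ℝ) :
    0 ≤ α (quadExt Δφ Δs a b gs gφ₁ gφ₂) := by
  have := h.dotProduct_mulVec_nonneg ![a, b]
  rwa [star_trivial, alphaExt_quadForm] at this

/-- *"it allows for solutions of crossing containing terms of the form `Σ_i (λ_i λ_i)(V⃗ + V⃗ ⊗ (1 0;0 0))
(λ_i; λ_i)`, where (the `λ_i`) represent an arbitrary number of (not necessarily aligned) two-component
vectors"*: under `⪰ 0` any such finite sum is `≥ 0` after applying `α`, so `⪰ 0` cannot exclude it.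
[cite: KosPolandSimmonsDuffinVichi2016, §2.1 (strong version; arXiv:1603.04436)] -/
theorem sum_quadExt_nonneg_of_posSemidef (α : (ℝ → ℝ → Fin 7 → ℝ) →ₗ[ℝ] ℝ) {Δφ Δs : ℝ}
    {gs gφ₁ gφ₂ : ℝ → ℝ → ℝ} (h : (alphaExt α Δφ Δs gs gφ₁ gφ₂).PosSemidef) {κ : Type*}
    (t : Finset κ) (a b : κ → ℝ) :
    0 ≤ ∑ i ∈ t, α (quadExt Δφ Δs (a i) (b i) gs gφ₁ gφ₂) :=
  Finset.sum_nonneg fun i _ => quadExt_nonneg_of_posSemidef α h (a i) (b i)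

/-- **The 2016 condition** ("weaker condition", `(cos θ_N sin θ_N) α⃗·(…) (cos θ_N; sin θ_N) ≥ 0`, typed for a
direction `(c, d)`): it makes the applied externals' term `≥ 0` for couplings `(a, b) = λ (c, d)` ALONG that
direction (any real `λ`). [cite: KosPolandSimmonsDuffinVichi2016, §2.1 (weaker condition), §2.2 (`θ_N` condition; arXiv:1603.04436)] -/
theorem quadExt_nonneg_of_dir (α : (ℝ → ℝ → Fin 7 → ℝ) →ₗ[ℝ] ℝ) {Δφ Δs : ℝ}
    {gs gφ₁ gφ₂ : ℝ → ℝ → ℝ} {c d : ℝ}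
    (h : 0 ≤ ![c, d] ⬝ᵥ (alphaExt α Δφ Δs gs gφ₁ gφ₂ *ᵥ ![c, d])) (lam : ℝ) :
    0 ≤ α (quadExt Δφ Δs (lam * c) (lam * d) gs gφ₁ gφ₂) := by
  rw [alphaExt_quadForm] at h
  rw [quadExt_smul, map_smul, smul_eq_mul]
  exact mul_nonneg (sq_nonneg _) h

/-- *"(the `⪰ 0` condition) is still stronger than necessary"*: `⪰ 0` implies the direction condition for
every direction. [cite: KosPolandSimmonsDuffinVichi2016, §2.1 (weaker condition; arXiv:1603.04436)] -/
theorem dir_nonneg_of_posSemidef (α : (ℝ → ℝ → Fin 7 → ℝ) →ₗ[ℝ] ℝ) {Δφ Δs : ℝ}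
    {gs gφ₁ gφ₂ : ℝ → ℝ → ℝ} (h : (alphaExt α Δφ Δs gs gφ₁ gφ₂).PosSemidef) (c d : ℝ) :
    0 ≤ ![c, d] ⬝ᵥ (alphaExt α Δφ Δs gs gφ₁ gφ₂ *ᵥ ![c, d]) := by
  have := h.dotProduct_mulVec_nonneg ![c, d]
  rwa [star_trivial] at this

/-- `c · (1 0; 0 0) ⪰ 0` for `c ≥ 0`. [cite: KosPolandSimmonsDuffinVichi2015, §2.2 (example SDP: "each of the terms … independently positive-semidefinite")] -/
theorem posSemidef_smul_E11 {c : ℝ} (hc : 0 ≤ c) : (c • E11).PosSemidef := by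
  refine PosSemidef.of_dotProduct_mulVec_nonneg ?_ fun x => ?_
  · unfold Matrix.IsHermitian
    ext i j
    fin_cases i <;> fin_cases j <;> simp [E11]
  · have hx : ![x 0, x 1] = x := by
      funext i
      fin_cases i <;> rfl
    rw [star_trivial, ← hx, Matrix.smul_mulVec, dotProduct_smul, E11_quadForm, smul_eq_mul]
    exact mul_nonneg hc (sq_nonneg _)

/-- **"No effect without gaps"**: *"each of the terms in this constraint would be independently
positive-semidefinite, since the other inequalities imply `α⃗·V⃗_{S,Δ_s+δ,0} ⪰ 0` and `α⃗·V⃗_{V,Δ_φ+δ,0} ≥ 0`"* —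
if `α⃗·V⃗_S[gs] ⪰ 0` and `α(V⃗_V[1; gφ₁, gφ₂]) ≥ 0` separately then the combined matrix is `⪰ 0` automatically.
[cite: KosPolandSimmonsDuffinVichi2015, §2.2 (example SDP, no-gap remark)] -/
theorem posSemidef_alphaExt_of_parts (α : (ℝ → ℝ → Fin 7 → ℝ) →ₗ[ℝ] ℝ) {Δφ Δs : ℝ}
    {gs gφ₁ gφ₂ : ℝ → ℝ → ℝ} (hS : (alphaVS α Δφ Δs gs).PosSemidef)
    (hV : 0 ≤ α (V7V Δφ Δs 1 gφ₁ gφ₂)) : (alphaExt α Δφ Δs gs gφ₁ gφ₂).PosSemidef :=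
  hS.add (posSemidef_smul_E11 hV)

/-! ## 3. The scan over the unknown angle -/

/-- *"for some unknown angle `θ_N ≡ tan⁻¹(λ_{sss}/λ_{ssφ})`"* (sic: the denominator is `λ_{φφs}`, cf. the next
paragraph's *"`λ_s ≡ √(λ²_{φφs} + λ²_{sss})`"*), made total (`tan⁻¹` only sees a half-turn):
every coupling pair is `(a, b) = λ (cos θ, sin θ)` with `λ ≥ 0`, `λ² = a² + b²`, `θ ∈ (−π, π]`.
[cite: KosPolandSimmonsDuffinVichi2016, §2.2 (`θ_N`, `λ_s`; arXiv:1603.04436)] -/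
theorem exists_norm_angle (a b : ℝ) :
    ∃ lam θ : ℝ, 0 ≤ lam ∧ θ ∈ Set.Ioc (-Real.pi) Real.pi ∧ lam ^ 2 = a ^ 2 + b ^ 2 ∧
      a = lam * Real.cos θ ∧ b = lam * Real.sin θ := by
  refine ⟨‖(⟨a, b⟩ : ℂ)‖, Complex.arg ⟨a, b⟩, norm_nonneg _,
    ⟨Complex.neg_pi_lt_arg _, Complex.arg_le_pi _⟩, ?_, ?_, ?_⟩
  · rw [Complex.sq_norm, Complex.normSq_mk]
    ring
  · exact (Complex.norm_mul_cos_arg (⟨a, b⟩ : ℂ)).symm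
  · exact (Complex.norm_mul_sin_arg (⟨a, b⟩ : ℂ)).symm

/-- The same with the angle confined to a half-turn `θ ∈ [0, π)` and a SIGNED `λ` (`λ² = a² + b²`): by
`quadExt_neg` the sign of `λ` is invisible to the sum rules, so scanning `θ ∈ [0, π)` is exhaustive.
[cite: KosPolandSimmonsDuffinVichi2016, §2.1–§2.2 (`θ`-scan; arXiv:1603.04436)] -/
theorem exists_norm_angle_Ico (a b : ℝ) :
    ∃ lam θ : ℝ, θ ∈ Set.Ico 0 Real.pi ∧ lam ^ 2 = a ^ 2 + b ^ 2 ∧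
      a = lam * Real.cos θ ∧ b = lam * Real.sin θ := by
  obtain ⟨lam, θ₀, -, ⟨h1, h2⟩, hsq, ha, hb⟩ := exists_norm_angle a b
  by_cases hlo : 0 ≤ θ₀
  · rcases lt_or_eq_of_le h2 with hlt | heq
    · exact ⟨lam, θ₀, ⟨hlo, hlt⟩, hsq, ha, hb⟩
    · -- `θ₀ = π`: use `θ = 0` with the sign moved into `λ`
      refine ⟨-lam, 0, ⟨le_rfl, Real.pi_pos⟩, by rw [neg_sq, hsq], ?_, ?_⟩
      · rw [ha, heq, Real.cos_pi, Real.cos_zero]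
        ring
      · rw [hb, heq, Real.sin_pi, Real.sin_zero]
        ring
  · -- `θ₀ ∈ (−π, 0)`: use `θ = θ₀ + π` with the sign moved into `λ`
    have hlo' : θ₀ < 0 := lt_of_not_ge hlo
    refine ⟨-lam, θ₀ + Real.pi, ⟨by linarith, by linarith⟩, by rw [neg_sq, hsq], ?_, ?_⟩
    · rw [ha, Real.cos_add_pi]
      ring
    · rw [hb, Real.sin_add_pi]
      ring

/-- **"By scanning over the possible values of `θ` and taking the union of the resulting allowed regions"**:
a point excluded at EVERY angle (`hscan : ∀ θ, P θ`, `P θ` = "an excluding functional obeying the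
`θ`-condition exists") is excluded outright, because the true couplings `(a, b)` have SOME angle, at which
the exclusion contradicts the data (`hdata`, supplied by `false_of_functional₇_dir` below instantiated with
the CFT data). [cite: KosPolandSimmonsDuffinVichi2016, §2.1–§2.2 (`θ`-scan; arXiv:1603.04436)] -/
theorem false_of_forall_angle {P : ℝ → Prop} (a b : ℝ) (hscan : ∀ θ, P θ)
    (hdata : ∀ lam θ : ℝ, 0 ≤ lam → a = lam * Real.cos θ → b = lam * Real.sin θ → ¬P θ) : False := by
  obtain ⟨lam, θ, hl, -, -, ha, hb⟩ := exists_norm_angle a b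
  exact hdata lam θ hl ha hb (hscan θ)

/-! ## 4. The seven rows with the unit and the isolated externals split off -/

/-- The seven rows at channel-sum level with the unit operator AND the isolated externals isolated:
`mixedVec = (1 1) V⃗_{S,0,0} (1 1)ᵀ + (a b)(V⃗_S[gs] + V⃗_V ⊗ (1 0;0 0))(a b)ᵀ + singletVec[remainders] + V⃗_T[G_T]
+ V⃗_A[G_A] + vectorVec[remainders]`, where the singlet remainders are `G^{φφ}_S − 1 − a² gs`,
`G^{φs}_S − 1 − ab gs`, `G^{ss}_S − 1 − b² gs` and the vector remainders `G_{V,1} − a² gφ₁`, `G_{V,2} − a² gφ₂`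
(`a = λ_{φφs} = λ_{φsφ}`, `b = λ_{sss}`). [cite: KosPolandSimmonsDuffinVichi2016, §2.2 (7 sum rules with isolated `φ_i`, `s`; arXiv:1603.04436)] -/
theorem mixedVec_ext_split (Δφ Δs a b : ℝ)
    (gs gφ₁ gφ₂ GSφφ GSss GSφs GT GA GV₁ GV₂ : ℝ → ℝ → ℝ) :
    mixedVec N Δφ Δs GSφφ GSss GSφs GT GA GV₁ GV₂ =
      quadVS Δφ Δs 1 1 (fun _ _ => (1 : ℝ)) + quadExt Δφ Δs a b gs gφ₁ gφ₂ +
        singletVec Δφ Δs (fun u v => GSφφ u v - 1 - a ^ 2 * gs u v)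
          (fun u v => GSφs u v - 1 - a * b * gs u v) (fun u v => GSss u v - 1 - b ^ 2 * gs u v) +
        V7T N Δφ GT + V7A Δφ GA +
        vectorVec Δφ Δs (fun u v => GV₁ u v - a ^ 2 * gφ₁ u v)
          (fun u v => GV₂ u v - a ^ 2 * gφ₂ u v) := by
  funext u v r
  simp only [Pi.add_apply, quadVS_eq, quadExt_eq_vec]
  fin_cases r <;> simp [mixedVec, singletVec, V7T, V7A, vectorVec, Fm, Fp] <;> ring

/-! ## 5. Exclusion with the direction (`θ_N`) condition for the isolated externals -/

/-- **The exclusion argument with isolated externals** (abstract form).  Data: the isolated externals —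
couplings `(λ_{φφs}, λ_{sss}) = (a, b) = λ (c, d)` along a direction `(c, d)` (the source's
`(cos θ_N, sin θ_N)`), blocks `gs` (of `s` in `V⃗_S`) and `gφ₁, gφ₂` (of `φ` in `V⃗_V`, coupling
`λ²_{φsφ} = a²`); singlets `𝒪 ∈ ιS` OTHER than the unit and `s` (couplings `(aS, bS)`), `T`, `A` families,
`O(N)` vectors `𝒪 ∈ ιV` OTHER than `φ` (weights `λ² ≥ 0`, signs `ε`); channel sums with the unit and the
externals INCLUDED.  Hypotheses: `α` applies termwise to the four remainder series (`hS`, `hT`, `hA`, `hV`),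
annihilates the channel-level sum rule (`hzero`), and satisfies the 2016 §2.2 conditions —
`(1 1) α⃗·V⃗_{S,0,0} (1 1)ᵀ > 0` (strict, module docstring), `α⃗·V⃗_T ≥ 0`, `α⃗·V⃗_A ≥ 0`, `α⃗·V⃗_V ≥ 0`,
`α⃗·V⃗_S ⪰ 0` on the families, and the direction condition
`(c d) α⃗·(V⃗_{S,Δ_s,0} + V⃗_{V,Δ_φ,0} ⊗ (1 0;0 0)) (c d)ᵀ ≥ 0`.  Conclusion: contradiction.
[cite: KosPolandSimmonsDuffinVichi2016, §2.2 (generic conditions and `θ_N` condition; arXiv:1603.04436)] -/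
theorem false_of_functional₇_dir (α : (ℝ → ℝ → Fin 7 → ℝ) →ₗ[ℝ] ℝ) {Δφ Δs : ℝ}
    {ιS ιT ιA ιV : Type*} {aS bS : ιS → ℝ} {pT : ιT → ℝ} {pA : ιA → ℝ} {pV ε : ιV → ℝ}
    {gS : ιS → ℝ → ℝ → ℝ} {gT : ιT → ℝ → ℝ → ℝ} {gA : ιA → ℝ → ℝ → ℝ}
    {gV₁ gV₂ : ιV → ℝ → ℝ → ℝ} {gs gφ₁ gφ₂ GSφφ GSss GSφs GT GA GV₁ GV₂ : ℝ → ℝ → ℝ}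
    {a b lam c d : ℝ} (ha : a = lam * c) (hb : b = lam * d)
    (hpT : ∀ o, 0 ≤ pT o) (hpA : ∀ o, 0 ≤ pA o) (hpV : ∀ o, 0 ≤ pV o)
    (hS : HasSum (fun o => α (quadVS Δφ Δs (aS o) (bS o) (gS o)))
      (α (singletVec Δφ Δs (fun u v => GSφφ u v - 1 - a ^ 2 * gs u v)
        (fun u v => GSφs u v - 1 - a * b * gs u v) fun u v => GSss u v - 1 - b ^ 2 * gs u v)))
    (hT : HasSum (fun o => pT o * α (V7T N Δφ (gT o))) (α (V7T N Δφ GT)))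
    (hA : HasSum (fun o => pA o * α (V7A Δφ (gA o))) (α (V7A Δφ GA)))
    (hV : HasSum (fun o => pV o * α (V7V Δφ Δs (ε o) (gV₁ o) (gV₂ o)))
      (α (vectorVec Δφ Δs (fun u v => GV₁ u v - a ^ 2 * gφ₁ u v)
        fun u v => GV₂ u v - a ^ 2 * gφ₂ u v)))
    (hzero : α (mixedVec N Δφ Δs GSφφ GSss GSφs GT GA GV₁ GV₂) = 0)
    (hunit : 0 < ![(1 : ℝ), 1] ⬝ᵥ (alphaVS α Δφ Δs (fun _ _ => (1 : ℝ)) *ᵥ ![(1 : ℝ), 1]))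
    (hposT : ∀ o, 0 ≤ α (V7T N Δφ (gT o))) (hposA : ∀ o, 0 ≤ α (V7A Δφ (gA o)))
    (hposV : ∀ o, 0 ≤ α (V7V Δφ Δs (ε o) (gV₁ o) (gV₂ o)))
    (hposS : ∀ o, (alphaVS α Δφ Δs (gS o)).PosSemidef)
    (hdir : 0 ≤ ![c, d] ⬝ᵥ (alphaExt α Δφ Δs gs gφ₁ gφ₂ *ᵥ ![c, d])) : False := by
  have nS : 0 ≤ α (singletVec Δφ Δs (fun u v => GSφφ u v - 1 - a ^ 2 * gs u v)
      (fun u v => GSφs u v - 1 - a * b * gs u v) fun u v => GSss u v - 1 - b ^ 2 * gs u v) :=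
    hS.nonneg fun o => quadVS_nonneg_of_posSemidef α (hposS o) (aS o) (bS o)
  have nT : 0 ≤ α (V7T N Δφ GT) := hT.nonneg fun o => mul_nonneg (hpT o) (hposT o)
  have nA : 0 ≤ α (V7A Δφ GA) := hA.nonneg fun o => mul_nonneg (hpA o) (hposA o)
  have nV : 0 ≤ α (vectorVec Δφ Δs (fun u v => GV₁ u v - a ^ 2 * gφ₁ u v)
      fun u v => GV₂ u v - a ^ 2 * gφ₂ u v) :=
    hV.nonneg fun o => mul_nonneg (hpV o) (hposV o)
  have nE : 0 ≤ α (quadExt Δφ Δs a b gs gφ₁ gφ₂) := by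
    rw [ha, hb]
    exact quadExt_nonneg_of_dir α hdir lam
  rw [alphaVS_quadForm] at hunit
  rw [mixedVec_ext_split Δφ Δs a b gs gφ₁ gφ₂, map_add, map_add, map_add, map_add, map_add] at hzero
  linarith

/-- The same with the source's unit direction `(cos θ_N, sin θ_N)` and `λ = λ_s ≥ 0` literally.
[cite: KosPolandSimmonsDuffinVichi2016, §2.2 (`θ_N` condition; arXiv:1603.04436)] -/
theorem false_of_functional₇_angle (α : (ℝ → ℝ → Fin 7 → ℝ) →ₗ[ℝ] ℝ) {Δφ Δs : ℝ}
    {ιS ιT ιA ιV : Type*} {aS bS : ιS → ℝ} {pT : ιT → ℝ} {pA : ιA → ℝ} {pV ε : ιV → ℝ}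
    {gS : ιS → ℝ → ℝ → ℝ} {gT : ιT → ℝ → ℝ → ℝ} {gA : ιA → ℝ → ℝ → ℝ}
    {gV₁ gV₂ : ιV → ℝ → ℝ → ℝ} {gs gφ₁ gφ₂ GSφφ GSss GSφs GT GA GV₁ GV₂ : ℝ → ℝ → ℝ}
    {a b lam θ : ℝ} (ha : a = lam * Real.cos θ) (hb : b = lam * Real.sin θ)
    (hpT : ∀ o, 0 ≤ pT o) (hpA : ∀ o, 0 ≤ pA o) (hpV : ∀ o, 0 ≤ pV o)
    (hS : HasSum (fun o => α (quadVS Δφ Δs (aS o) (bS o) (gS o)))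
      (α (singletVec Δφ Δs (fun u v => GSφφ u v - 1 - a ^ 2 * gs u v)
        (fun u v => GSφs u v - 1 - a * b * gs u v) fun u v => GSss u v - 1 - b ^ 2 * gs u v)))
    (hT : HasSum (fun o => pT o * α (V7T N Δφ (gT o))) (α (V7T N Δφ GT)))
    (hA : HasSum (fun o => pA o * α (V7A Δφ (gA o))) (α (V7A Δφ GA)))
    (hV : HasSum (fun o => pV o * α (V7V Δφ Δs (ε o) (gV₁ o) (gV₂ o)))
      (α (vectorVec Δφ Δs (fun u v => GV₁ u v - a ^ 2 * gφ₁ u v)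
        fun u v => GV₂ u v - a ^ 2 * gφ₂ u v)))
    (hzero : α (mixedVec N Δφ Δs GSφφ GSss GSφs GT GA GV₁ GV₂) = 0)
    (hunit : 0 < ![(1 : ℝ), 1] ⬝ᵥ (alphaVS α Δφ Δs (fun _ _ => (1 : ℝ)) *ᵥ ![(1 : ℝ), 1]))
    (hposT : ∀ o, 0 ≤ α (V7T N Δφ (gT o))) (hposA : ∀ o, 0 ≤ α (V7A Δφ (gA o)))
    (hposV : ∀ o, 0 ≤ α (V7V Δφ Δs (ε o) (gV₁ o) (gV₂ o)))
    (hposS : ∀ o, (alphaVS α Δφ Δs (gS o)).PosSemidef)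
    (hangle : 0 ≤ ![Real.cos θ, Real.sin θ] ⬝ᵥ
      (alphaExt α Δφ Δs gs gφ₁ gφ₂ *ᵥ ![Real.cos θ, Real.sin θ])) : False :=
  false_of_functional₇_dir α ha hb hpT hpA hpV hS hT hA hV hzero hunit hposT hposA hposV hposS hangle

/-! ## 6. Lower and upper bounds on the norm of the OPE-coefficient vector -/

/-- **`𝒩 λ² ≤ −(1 1) α⃗·V⃗_{S,0,0} (1 1)ᵀ`**.  Same data and termwise / positivity hypotheses as
`false_of_functional₇_dir`, but NO condition on the unit, and the direction form takes an arbitrary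
prescribed value `𝒩 = (c d) α⃗·(V⃗_{S,Δ_s,0} + V⃗_{V,Δ_φ,0} ⊗ (1 0;0 0)) (c d)ᵀ`; conclusion: for couplings
`(a, b) = λ (c, d)`, `𝒩 λ² ≤ −(1 1) α⃗·V⃗_{S,0,0} (1 1)ᵀ` (the objective being maximised in the source).
[cite: KosPolandSimmonsDuffinVichi2016, §2.1 (norm bounds, `𝒩 λ² ≤ −(1 1) α⃗·V⃗ (1 1)ᵀ`), §2.2 ("Similarly … a lower and upper bound on the norm `λ_s`"; arXiv:1603.04436)] -/
theorem normSq_bound_of_functional₇ (α : (ℝ → ℝ → Fin 7 → ℝ) →ₗ[ℝ] ℝ) {Δφ Δs : ℝ}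
    {ιS ιT ιA ιV : Type*} {aS bS : ιS → ℝ} {pT : ιT → ℝ} {pA : ιA → ℝ} {pV ε : ιV → ℝ}
    {gS : ιS → ℝ → ℝ → ℝ} {gT : ιT → ℝ → ℝ → ℝ} {gA : ιA → ℝ → ℝ → ℝ}
    {gV₁ gV₂ : ιV → ℝ → ℝ → ℝ} {gs gφ₁ gφ₂ GSφφ GSss GSφs GT GA GV₁ GV₂ : ℝ → ℝ → ℝ}
    {a b lam c d 𝒩 : ℝ} (ha : a = lam * c) (hb : b = lam * d)
    (hpT : ∀ o, 0 ≤ pT o) (hpA : ∀ o, 0 ≤ pA o) (hpV : ∀ o, 0 ≤ pV o)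
    (hS : HasSum (fun o => α (quadVS Δφ Δs (aS o) (bS o) (gS o)))
      (α (singletVec Δφ Δs (fun u v => GSφφ u v - 1 - a ^ 2 * gs u v)
        (fun u v => GSφs u v - 1 - a * b * gs u v) fun u v => GSss u v - 1 - b ^ 2 * gs u v)))
    (hT : HasSum (fun o => pT o * α (V7T N Δφ (gT o))) (α (V7T N Δφ GT)))
    (hA : HasSum (fun o => pA o * α (V7A Δφ (gA o))) (α (V7A Δφ GA)))
    (hV : HasSum (fun o => pV o * α (V7V Δφ Δs (ε o) (gV₁ o) (gV₂ o)))
      (α (vectorVec Δφ Δs (fun u v => GV₁ u v - a ^ 2 * gφ₁ u v)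
        fun u v => GV₂ u v - a ^ 2 * gφ₂ u v)))
    (hzero : α (mixedVec N Δφ Δs GSφφ GSss GSφs GT GA GV₁ GV₂) = 0)
    (hposT : ∀ o, 0 ≤ α (V7T N Δφ (gT o))) (hposA : ∀ o, 0 ≤ α (V7A Δφ (gA o)))
    (hposV : ∀ o, 0 ≤ α (V7V Δφ Δs (ε o) (gV₁ o) (gV₂ o)))
    (hposS : ∀ o, (alphaVS α Δφ Δs (gS o)).PosSemidef)
    (hnorm : ![c, d] ⬝ᵥ (alphaExt α Δφ Δs gs gφ₁ gφ₂ *ᵥ ![c, d]) = 𝒩) :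
    𝒩 * lam ^ 2 ≤ -(![(1 : ℝ), 1] ⬝ᵥ (alphaVS α Δφ Δs (fun _ _ => (1 : ℝ)) *ᵥ ![(1 : ℝ), 1])) := by
  have nS : 0 ≤ α (singletVec Δφ Δs (fun u v => GSφφ u v - 1 - a ^ 2 * gs u v)
      (fun u v => GSφs u v - 1 - a * b * gs u v) fun u v => GSss u v - 1 - b ^ 2 * gs u v) :=
    hS.nonneg fun o => quadVS_nonneg_of_posSemidef α (hposS o) (aS o) (bS o)
  have nT : 0 ≤ α (V7T N Δφ GT) := hT.nonneg fun o => mul_nonneg (hpT o) (hposT o)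
  have nA : 0 ≤ α (V7A Δφ GA) := hA.nonneg fun o => mul_nonneg (hpA o) (hposA o)
  have nV : 0 ≤ α (vectorVec Δφ Δs (fun u v => GV₁ u v - a ^ 2 * gφ₁ u v)
      fun u v => GV₂ u v - a ^ 2 * gφ₂ u v) :=
    hV.nonneg fun o => mul_nonneg (hpV o) (hposV o)
  have e : α (quadExt Δφ Δs a b gs gφ₁ gφ₂) = lam ^ 2 * 𝒩 := by
    rw [ha, hb, quadExt_smul, map_smul, smul_eq_mul, ← alphaExt_quadForm, hnorm]
  rw [alphaVS_quadForm]
  rw [mixedVec_ext_split Δφ Δs a b gs gφ₁ gφ₂, map_add, map_add, map_add, map_add, map_add] at hzero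
  nlinarith [e]

/-- *"By choosing `𝒩 = ±1` we can obtain the sought upper and lower bounds"* — `𝒩 = 1`: the UPPER bound
`λ² ≤ −(1 1) α⃗·V⃗_{S,0,0} (1 1)ᵀ`. [cite: KosPolandSimmonsDuffinVichi2016, §2.1–§2.2 (norm bounds; arXiv:1603.04436)] -/
theorem normSq_le_of_functional₇ (α : (ℝ → ℝ → Fin 7 → ℝ) →ₗ[ℝ] ℝ) {Δφ Δs : ℝ}
    {ιS ιT ιA ιV : Type*} {aS bS : ιS → ℝ} {pT : ιT → ℝ} {pA : ιA → ℝ} {pV ε : ιV → ℝ}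
    {gS : ιS → ℝ → ℝ → ℝ} {gT : ιT → ℝ → ℝ → ℝ} {gA : ιA → ℝ → ℝ → ℝ}
    {gV₁ gV₂ : ιV → ℝ → ℝ → ℝ} {gs gφ₁ gφ₂ GSφφ GSss GSφs GT GA GV₁ GV₂ : ℝ → ℝ → ℝ}
    {a b lam c d : ℝ} (ha : a = lam * c) (hb : b = lam * d)
    (hpT : ∀ o, 0 ≤ pT o) (hpA : ∀ o, 0 ≤ pA o) (hpV : ∀ o, 0 ≤ pV o)
    (hS : HasSum (fun o => α (quadVS Δφ Δs (aS o) (bS o) (gS o)))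
      (α (singletVec Δφ Δs (fun u v => GSφφ u v - 1 - a ^ 2 * gs u v)
        (fun u v => GSφs u v - 1 - a * b * gs u v) fun u v => GSss u v - 1 - b ^ 2 * gs u v)))
    (hT : HasSum (fun o => pT o * α (V7T N Δφ (gT o))) (α (V7T N Δφ GT)))
    (hA : HasSum (fun o => pA o * α (V7A Δφ (gA o))) (α (V7A Δφ GA)))
    (hV : HasSum (fun o => pV o * α (V7V Δφ Δs (ε o) (gV₁ o) (gV₂ o)))
      (α (vectorVec Δφ Δs (fun u v => GV₁ u v - a ^ 2 * gφ₁ u v)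
        fun u v => GV₂ u v - a ^ 2 * gφ₂ u v)))
    (hzero : α (mixedVec N Δφ Δs GSφφ GSss GSφs GT GA GV₁ GV₂) = 0)
    (hposT : ∀ o, 0 ≤ α (V7T N Δφ (gT o))) (hposA : ∀ o, 0 ≤ α (V7A Δφ (gA o)))
    (hposV : ∀ o, 0 ≤ α (V7V Δφ Δs (ε o) (gV₁ o) (gV₂ o)))
    (hposS : ∀ o, (alphaVS α Δφ Δs (gS o)).PosSemidef)
    (hnorm : ![c, d] ⬝ᵥ (alphaExt α Δφ Δs gs gφ₁ gφ₂ *ᵥ ![c, d]) = 1) :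
    lam ^ 2 ≤ -(![(1 : ℝ), 1] ⬝ᵥ (alphaVS α Δφ Δs (fun _ _ => (1 : ℝ)) *ᵥ ![(1 : ℝ), 1])) := by
  have := normSq_bound_of_functional₇ α ha hb hpT hpA hpV hS hT hA hV hzero hposT hposA hposV hposS
    hnorm
  linarith

/-- `𝒩 = −1`: the LOWER bound `(1 1) α⃗·V⃗_{S,0,0} (1 1)ᵀ ≤ λ²`.
[cite: KosPolandSimmonsDuffinVichi2016, §2.1–§2.2 (norm bounds; arXiv:1603.04436)] -/
theorem le_normSq_of_functional₇ (α : (ℝ → ℝ → Fin 7 → ℝ) →ₗ[ℝ] ℝ) {Δφ Δs : ℝ}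
    {ιS ιT ιA ιV : Type*} {aS bS : ιS → ℝ} {pT : ιT → ℝ} {pA : ιA → ℝ} {pV ε : ιV → ℝ}
    {gS : ιS → ℝ → ℝ → ℝ} {gT : ιT → ℝ → ℝ → ℝ} {gA : ιA → ℝ → ℝ → ℝ}
    {gV₁ gV₂ : ιV → ℝ → ℝ → ℝ} {gs gφ₁ gφ₂ GSφφ GSss GSφs GT GA GV₁ GV₂ : ℝ → ℝ → ℝ}
    {a b lam c d : ℝ} (ha : a = lam * c) (hb : b = lam * d)
    (hpT : ∀ o, 0 ≤ pT o) (hpA : ∀ o, 0 ≤ pA o) (hpV : ∀ o, 0 ≤ pV o)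
    (hS : HasSum (fun o => α (quadVS Δφ Δs (aS o) (bS o) (gS o)))
      (α (singletVec Δφ Δs (fun u v => GSφφ u v - 1 - a ^ 2 * gs u v)
        (fun u v => GSφs u v - 1 - a * b * gs u v) fun u v => GSss u v - 1 - b ^ 2 * gs u v)))
    (hT : HasSum (fun o => pT o * α (V7T N Δφ (gT o))) (α (V7T N Δφ GT)))
    (hA : HasSum (fun o => pA o * α (V7A Δφ (gA o))) (α (V7A Δφ GA)))
    (hV : HasSum (fun o => pV o * α (V7V Δφ Δs (ε o) (gV₁ o) (gV₂ o)))
      (α (vectorVec Δφ Δs (fun u v => GV₁ u v - a ^ 2 * gφ₁ u v)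
        fun u v => GV₂ u v - a ^ 2 * gφ₂ u v)))
    (hzero : α (mixedVec N Δφ Δs GSφφ GSss GSφs GT GA GV₁ GV₂) = 0)
    (hposT : ∀ o, 0 ≤ α (V7T N Δφ (gT o))) (hposA : ∀ o, 0 ≤ α (V7A Δφ (gA o)))
    (hposV : ∀ o, 0 ≤ α (V7V Δφ Δs (ε o) (gV₁ o) (gV₂ o)))
    (hposS : ∀ o, (alphaVS α Δφ Δs (gS o)).PosSemidef)
    (hnorm : ![c, d] ⬝ᵥ (alphaExt α Δφ Δs gs gφ₁ gφ₂ *ᵥ ![c, d]) = -1) :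
    ![(1 : ℝ), 1] ⬝ᵥ (alphaVS α Δφ Δs (fun _ _ => (1 : ℝ)) *ᵥ ![(1 : ℝ), 1]) ≤ lam ^ 2 := by
  have := normSq_bound_of_functional₇ α ha hb hpT hpA hpV hS hT hA hV hzero hposT hposA hposV hposS
    hnorm
  linarith

/-- With the unit direction `(cos θ, sin θ)` the bounded quantity is the squared norm of the
OPE-coefficient vector: `λ² = a² + b² = λ²_{φφs} + λ²_{sss}` (`λ_s ≡ √(λ²_{φφs} + λ²_{sss})`).
[cite: KosPolandSimmonsDuffinVichi2016, §2.2 (`λ_s`; arXiv:1603.04436)] -/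
theorem normSq_eq_of_angle {a b lam θ : ℝ} (ha : a = lam * Real.cos θ) (hb : b = lam * Real.sin θ) :
    a ^ 2 + b ^ 2 = lam ^ 2 := by
  rw [ha, hb, mul_pow, mul_pow, ← mul_add, Real.cos_sq_add_sin_sq, mul_one]

/-! ## 7. Point functionals: every hypothesis explicit -/

/-- **Exclusion by a point functional with isolated externals, all hypotheses explicit** (`2 ≤ N`).
Data as in `ONMixedSumRule.false_of_pointFunctional₇` except that the isolated externals are separate:
couplings `(a, b) = λ (c, d)` (`a = λ_{φφs} = λ_{φsφ}`, `b = λ_{sss}`), blocks `gs, gφ₁, gφ₂`; the singlet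
family `ιS` excludes the unit and `s`, the vector family `ιV` excludes `φ`; channel sums INCLUDE the unit and
the externals (so the remainder series converge to `G − 1 − (external term)`).  Hypotheses: pointwise
convergence of the seven channel expansions at every `(u_m, v_m)` and `(v_m, u_m)`; crossing symmetry of
the system at every `(u_m, v_m)`; and for `α = pointFunctional₇ w u v` the 2016 §2.2 conditions with the
direction condition for the externals.  Conclusion: contradiction.
[cite: KosPolandSimmonsDuffinVichi2016, §2.2 (generic conditions and `θ_N` condition; arXiv:1603.04436)]
[cite: HogervorstRychkov2013, §4.3] -/
theorem false_of_pointFunctional₇_dir (hN : 2 ≤ N) {M : ℕ} (w : Fin M → Fin 7 → ℝ)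
    (u v : Fin M → ℝ) {Δφ Δs : ℝ} {ιS ιT ιA ιV : Type*} {aS bS : ιS → ℝ} {pT : ιT → ℝ}
    {pA : ιA → ℝ} {pV ε : ιV → ℝ} {gS : ιS → ℝ → ℝ → ℝ} {gT : ιT → ℝ → ℝ → ℝ}
    {gA : ιA → ℝ → ℝ → ℝ} {gV₁ gV₂ : ιV → ℝ → ℝ → ℝ}
    {gs gφ₁ gφ₂ GSφφ GSss GSφs GT GA GV₁ GV₂ : ℝ → ℝ → ℝ} {a b lam c d : ℝ}
    (ha : a = lam * c) (hb : b = lam * d)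
    (hpT : ∀ o, 0 ≤ pT o) (hpA : ∀ o, 0 ≤ pA o) (hpV : ∀ o, 0 ≤ pV o)
    (hSφφ : ∀ m, HasSum (fun o => aS o ^ 2 * gS o (u m) (v m))
      (GSφφ (u m) (v m) - 1 - a ^ 2 * gs (u m) (v m)))
    (hSφφ' : ∀ m, HasSum (fun o => aS o ^ 2 * gS o (v m) (u m))
      (GSφφ (v m) (u m) - 1 - a ^ 2 * gs (v m) (u m)))
    (hSφs : ∀ m, HasSum (fun o => aS o * bS o * gS o (u m) (v m))
      (GSφs (u m) (v m) - 1 - a * b * gs (u m) (v m)))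
    (hSφs' : ∀ m, HasSum (fun o => aS o * bS o * gS o (v m) (u m))
      (GSφs (v m) (u m) - 1 - a * b * gs (v m) (u m)))
    (hSss : ∀ m, HasSum (fun o => bS o ^ 2 * gS o (u m) (v m))
      (GSss (u m) (v m) - 1 - b ^ 2 * gs (u m) (v m)))
    (hSss' : ∀ m, HasSum (fun o => bS o ^ 2 * gS o (v m) (u m))
      (GSss (v m) (u m) - 1 - b ^ 2 * gs (v m) (u m)))
    (hT : ∀ m, HasSum (fun o => pT o * gT o (u m) (v m)) (GT (u m) (v m)))
    (hT' : ∀ m, HasSum (fun o => pT o * gT o (v m) (u m)) (GT (v m) (u m)))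
    (hA : ∀ m, HasSum (fun o => pA o * gA o (u m) (v m)) (GA (u m) (v m)))
    (hA' : ∀ m, HasSum (fun o => pA o * gA o (v m) (u m)) (GA (v m) (u m)))
    (hV₁ : ∀ m, HasSum (fun o => pV o * gV₁ o (u m) (v m))
      (GV₁ (u m) (v m) - a ^ 2 * gφ₁ (u m) (v m)))
    (hV₁' : ∀ m, HasSum (fun o => pV o * gV₁ o (v m) (u m))
      (GV₁ (v m) (u m) - a ^ 2 * gφ₁ (v m) (u m)))
    (hV₂ : ∀ m, HasSum (fun o => pV o * ε o * gV₂ o (u m) (v m))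
      (GV₂ (u m) (v m) - a ^ 2 * gφ₂ (u m) (v m)))
    (hV₂' : ∀ m, HasSum (fun o => pV o * ε o * gV₂ o (v m) (u m))
      (GV₂ (v m) (u m) - a ^ 2 * gφ₂ (v m) (u m)))
    (hx : ∀ m, SystemCrossingAt N Δφ Δs GSφφ GSss GSφs GT GA GV₁ GV₂ (u m) (v m))
    (hunit : 0 < ![(1 : ℝ), 1] ⬝ᵥ
      (alphaVS (pointFunctional₇ w u v) Δφ Δs (fun _ _ => (1 : ℝ)) *ᵥ ![(1 : ℝ), 1]))
    (hposT : ∀ o, 0 ≤ pointFunctional₇ w u v (V7T N Δφ (gT o)))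
    (hposA : ∀ o, 0 ≤ pointFunctional₇ w u v (V7A Δφ (gA o)))
    (hposV : ∀ o, 0 ≤ pointFunctional₇ w u v (V7V Δφ Δs (ε o) (gV₁ o) (gV₂ o)))
    (hposS : ∀ o, (alphaVS (pointFunctional₇ w u v) Δφ Δs (gS o)).PosSemidef)
    (hdir : 0 ≤ ![c, d] ⬝ᵥ (alphaExt (pointFunctional₇ w u v) Δφ Δs gs gφ₁ gφ₂ *ᵥ ![c, d])) :
    False := by
  refine false_of_functional₇_dir (pointFunctional₇ w u v) ha hb hpT hpA hpV ?_ ?_ ?_ ?_ ?_ hunit hposT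
    hposA hposV hposS hdir (aS := aS) (bS := bS) (GSφφ := GSφφ) (GSss := GSss) (GSφs := GSφs)
    (GT := GT) (GA := GA) (GV₁ := GV₁) (GV₂ := GV₂)
  · -- the singlet remainder series
    exact hasSum_pointFunctional₇ w u v (f := fun o => quadVS Δφ Δs (aS o) (bS o) (gS o))
      (F := singletVec Δφ Δs (fun u' v' => GSφφ u' v' - 1 - a ^ 2 * gs u' v')
        (fun u' v' => GSφs u' v' - 1 - a * b * gs u' v') fun u' v' => GSss u' v' - 1 - b ^ 2 * gs u' v')
      fun m => hasSum_quadVS Δφ Δs (G₁₁ := fun u' v' => GSφφ u' v' - 1 - a ^ 2 * gs u' v')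
        (G₁₂ := fun u' v' => GSφs u' v' - 1 - a * b * gs u' v')
        (G₂₂ := fun u' v' => GSss u' v' - 1 - b ^ 2 * gs u' v')
        (hSφφ m) (hSφφ' m) (hSφs m) (hSφs' m) (hSss m) (hSss' m)
  · -- the `T` series
    have := hasSum_pointFunctional₇ w u v (f := fun o => pT o • V7T N Δφ (gT o)) (F := V7T N Δφ GT)
      fun m => hasSum_V7T Δφ (hT m) (hT' m)
    simpa [map_smul, smul_eq_mul] using this
  · -- the `A` series
    have := hasSum_pointFunctional₇ w u v (f := fun o => pA o • V7A Δφ (gA o)) (F := V7A Δφ GA)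
      fun m => hasSum_V7A Δφ (hA m) (hA' m)
    simpa [map_smul, smul_eq_mul] using this
  · -- the vector remainder series
    have := hasSum_pointFunctional₇ w u v (f := fun o => pV o • V7V Δφ Δs (ε o) (gV₁ o) (gV₂ o))
      (F := vectorVec Δφ Δs (fun u' v' => GV₁ u' v' - a ^ 2 * gφ₁ u' v')
        fun u' v' => GV₂ u' v' - a ^ 2 * gφ₂ u' v')
      fun m => hasSum_V7V Δφ Δs (G₁ := fun u' v' => GV₁ u' v' - a ^ 2 * gφ₁ u' v')
        (G₂ := fun u' v' => GV₂ u' v' - a ^ 2 * gφ₂ u' v') (hV₁ m) (hV₁' m) (hV₂ m) (hV₂' m)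
    simpa [map_smul, smul_eq_mul] using this
  · -- the seven equations hold at every evaluation point
    rw [pointFunctional₇_apply]
    refine Finset.sum_eq_zero fun m _ => Finset.sum_eq_zero fun r _ => ?_
    have := (systemCrossingAt_iff hN).mp (hx m)
    rw [this, Pi.zero_apply, mul_zero]

end Literature.MathematicalPhysics.QuantumFieldTheory.ONOPEAngleScan

end
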